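import Literature.NumberTheory.Sieve.CFSemigroupTwistedRenewal
import Literature.NumberTheory.Sieve.CFSemigroupLipAlgebra
import Literature.NumberTheory.LFunctions.EffectivePerronOrderTwo
import Mathlib.Analysis.Complex.RemovableSingularity
import HarnessLib

/-!
# Power saving for the congruence renewal count of `Γ_A` from finite-order twisted-resolvent bounds

[MageeOhWinter2019, §3.4]: the spectral bounds for the congruence transfer operators `𝓜_{s,q} = L_{s,q}`
[Thm. 4: (1) a uniform gap on `ℂ^{Γ_q} ⊖ 1` for `|Im s| ≤ b₀`, (2) Dolgopyat bounds for `|Im s| > b₀`] give, by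
Laplace inversion and a contour shift [Lemma 15 for the part orthogonal to constants, Lemma 16 for the constants,
Prop. 17], the power saving `N_q = main + O(q^C ‖g‖ e^{(δ−ε)a})`. This file PROVES that implication, at a fixed
level `q`, for the congruence renewal count of the boundary coding (`CFSemigroupTwistedRenewal.lean`)

  `N_q(X, x; ξ → ξ₀; G, Φ) = Σ_{w ∈ (A×A)^*, ξ σ_w = ξ₀, denom(M_w,x) Φ(pt_w x) ≤ X} Re G(pt_w x)`
  (`cfCongCountT A Θ G ξ ξ₀ X x`),

in RESOLVENT form. Over the countable family of pair-words `w` (lengths `ℓ_w = (denom(M_w,x) Φ(pt_w x))²`,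
weights `a_w = 𝟙{ξσ_w = ξ₀} Re G(pt_w x)`) the generalized Dirichlet series is EXACTLY the twisted resolvent
coefficient `D(s) = Σ_n (𝓜_sⁿ (G_s ⊗ δ_{ξ₀}))_ξ(x) = ((1 − 𝓜_s)^{-1} (G_s ⊗ δ_{ξ₀}))_ξ(x)`, `G_s = G · Φ^{-2s}`
(`dirSeries_cfPW_eq`; `cfCongRes`). With the decomposition
`(1 − 𝓜_s)^{-1} = lift((1 − L_s²)^{-1}) + (1 − B_s)^{-1} P₁` (`cfTwist_inverse_eq`, `B_s = 𝓜_s P₁` the part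
orthogonal to constants) and the resolvent pole of `(1 − L_s)^{-1}` at `δ_A` (`cfResolvent_pole'`), the function
`D(s) − r/(s − δ_A)`, `r = |Γ_q|^{-1} · ½ ν(G Φ^{-2δ_A}) h(x)/κ_A` (`cfCongResid`, `= |Γ_q|^{-1} δ_A c_{G,Φ}(x)`), has a
removable singularity at `δ_A` (`differentiableOn_cfCongReg`).

**Theorem** (`cfCongCountT_powerSaving_of_resolventBound`). Let `0 ≤ σ₀ < σ₁ < δ_A` and assume, for all `s` with
`Re s > σ₀`: `1 − L_s` is a unit if `s ≠ δ_A`, `1 + L_s` is a unit, and `1 − B_s` is a unit (at a fixed level with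
primitive twists these hold on `Re s ≥ δ_A`, cf. `isUnit_one_sub_cfTwB_delta`; on a strip to the left of `δ_A`
and with constants uniform in `q` they are the content of [MageeOhWinter2019, Thm. 4]); and assume the finite-order
bound `‖D(u+it) − r/(u+it−δ_A)‖ ≤ M(1+|t|)^κ` (`κ < 2`) for `σ₁ ≤ u ≤ δ_A + 1`, `u + it ≠ δ_A`. Then for `X ≥ √2`
`|N_q(X, x; ξ → ξ₀; G, Φ) − r X^{2δ_A}/δ_A| ≤ (r(2^{δ_A+1} + 1/δ_A) + M·(32/π)·2^{2+σ₁}·S(σ₁,κ)) · X^{2δ_A − 2(δ_A−σ₁)/3}`,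
with a constant LINEAR in `r ≤ |Γ_q|^{-1}·const` and `M` (so `M ≪ q^C` is exactly [MageeOhWinter2019, Thm. 1]'s
shape). Engine: `PerronTwo.abs_countFn_sub_main_le`; the case `q = 1`, `Φ ≡ 1` is `CFSemigroupRenewalPowerSaving`.

## References
* [MageeOhWinter2019] M. Magee, H. Oh, D. Winter, J. reine angew. Math. 753 (2019), §3.2 (3.4), §3.4 (Lemma 15,
  Lemma 16, Prop. 17), Thm. 4.
-/

noncomputable section

open Complex Filter Set Metric Real
open scoped Topology MatrixGroups

namespace Literature.NumberTheory.Sieve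

open Literature.NumberTheory.LFunctions

variable {A : Finset ℕ}

/-! ### Two analytic-function utilities -/

/-- `s ↦ T(s)(v(s))` is analytic when `T` (operator-valued) and `v` are. [folklore] -/
theorem analyticAt_clm_apply {E F : Type*} [NormedAddCommGroup E] [NormedSpace ℂ E] [NormedAddCommGroup F]
    [NormedSpace ℂ F] {T : ℂ → E →L[ℂ] F} {v : ℂ → E} {s : ℂ} (hT : AnalyticAt ℂ T s) (hv : AnalyticAt ℂ v s) :
    AnalyticAt ℂ (fun s => T s (v s)) s :=
  ((ContinuousLinearMap.apply ℂ F).analyticAt_bilinear (v s, T s)).comp₂ hv hT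

/-- `s ↦ (inverse of a unit-valued analytic operator family)` is analytic. [folklore] -/
theorem analyticAt_ring_inverse {E : Type*} [NormedAddCommGroup E] [NormedSpace ℂ E] [CompleteSpace E]
    {T : ℂ → E →L[ℂ] E} {s : ℂ} (hT : AnalyticAt ℂ T s) (hu : IsUnit (T s)) :
    AnalyticAt ℂ (fun s => Ring.inverse (T s)) s := by
  obtain ⟨u, hu⟩ := hu
  have h1 : AnalyticAt ℂ Ring.inverse (T s) := by rw [← hu]; exact analyticAt_inverse u
  exact AnalyticAt.comp (g := Ring.inverse) (f := T) (x := s) h1 hT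

/-! ### The family of pair-words: lengths and weights -/

/-- The pair-words `w ∈ (A × A)^*`. [cite: MageeOhWinter2019, §3.2] -/
abbrev cfPairWords (A : Finset ℕ) : Type := Σ n : ℕ, (Fin n → A × A)

variable (A) in
/-- The length `ℓ_w = (denom(M_w, x) Φ(pt_w x))²` of a pair-word. [cite: MageeOhWinter2019, §3.2] -/
def cfPWLen (Θ : CfThreshold) (x : ℝ) (w : cfPairWords A) : ℝ :=
  (cfDenom (cfPathMat A (List.ofFn w.2)) x * Θ.Φ (cfPathPoint A (List.ofFn w.2) x)) ^ 2

variable (A) in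
/-- The weight `a_w = 𝟙{ξ σ_w = ξ₀} Re G(pt_w x)` of a pair-word. [cite: MageeOhWinter2019, §3.2] -/
def cfPWWt (q : ℕ) (G : CfLip) (ξ ξ₀ : SL(2, ZMod q)) (x : ℝ) (w : cfPairWords A) : ℝ :=
  (if ξ * cfSigmaWord A q (List.ofFn w.2) = ξ₀ then (1 : ℝ) else 0) * (G.extend (cfPathPoint A (List.ofFn w.2) x)).re

/-- `ℓ_w ≥ 1` for `x ∈ [0,1]` (`denom ≥ 1`, `Φ ≥ 1`). [folklore] -/
theorem one_le_cfPWLen (hA : ∀ a ∈ A, 1 ≤ a) (Θ : CfThreshold) {x : ℝ} (hx : x ∈ Icc (0 : ℝ) 1)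
    (w : cfPairWords A) : 1 ≤ cfPWLen A Θ x w := by
  have hd := one_le_cfDenom_cfPathMat A hA (List.ofFn w.2) hx
  have hΦ := Θ.one_le _ (cfPathPoint_mem A hA (List.ofFn w.2) hx)
  unfold cfPWLen
  nlinarith [mul_le_mul hd hΦ zero_le_one (by linarith)]

/-- `a_w ≥ 0` for `G ≥ 0`. [folklore] -/
theorem cfPWWt_nonneg {q : ℕ} {G : CfLip} (hG0 : ∀ y : Icc (0 : ℝ) 1, 0 ≤ (G y).re) (ξ ξ₀ : SL(2, ZMod q)) (x : ℝ)
    (w : cfPairWords A) : 0 ≤ cfPWWt A q G ξ ξ₀ x w := by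
  unfold cfPWWt
  split_ifs
  · rw [one_mul]; exact hG0 _
  · rw [zero_mul]

/-- **The complex power of the length:** `((d Φ)²)^{-s} = denom^{-2s} · e^{-2s log Φ}`. [folklore] -/
theorem cpow_neg_sq_mul (s : ℂ) (M : Matrix (Fin 2) (Fin 2) ℤ) {x φ : ℝ} (hd : 0 < cfDenom M x) (hφ : 0 < φ) :
    ((((cfDenom M x * φ) ^ 2 : ℝ)) : ℂ) ^ (-s) = cfWt s M x * Complex.exp (-(2 * s * (Real.log φ : ℂ))) := by
  have hp : (0 : ℝ) < (cfDenom M x * φ) ^ 2 := by positivity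
  rw [cfWt, ← Complex.exp_add, cpow_def_of_ne_zero (ofReal_ne_zero.2 hp.ne'), ← ofReal_log hp.le, Real.log_pow,
    Real.log_mul hd.ne' hφ.ne']
  congr 1
  push_cast
  ring

/-! ### The test family, the fiber sums and the resolvent coefficient -/

section Family

variable {q : ℕ} (Θ : CfThreshold)

variable (q) in
/-- The test family in the fibre `ξ₀`: `G_s ⊗ δ_{ξ₀}` with `G_s = G · Φ^{-2s}`. [cite: MageeOhWinter2019, §3.2] -/
def cfFamS (G : CfLip) (ξ₀ : SL(2, ZMod q)) (s : ℂ) : SL(2, ZMod q) → CfLip := cfTwSingle q ξ₀ (Θ.cfPowFam G 2 s)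

variable (q) in
/-- The twisted resolvent coefficient `D(s) = ((1 − 𝓜_s)^{-1}(G_s ⊗ δ_{ξ₀}))_ξ(x)` (the genuine resolvent off the
poles). [cite: MageeOhWinter2019, §3.2 (3.4)] -/
def cfCongRes (hA : ∀ a ∈ A, 1 ≤ a) (G : CfLip) (ξ ξ₀ : SL(2, ZMod q)) (x : Icc (0 : ℝ) 1) (s : ℂ) : ℂ :=
  (Ring.inverse (1 - cfTwist A hA q s) (cfFamS q Θ G ξ₀ s)) ξ x

/-- `s ↦ G_s ⊗ δ_{ξ₀}` is entire. [folklore] -/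
theorem analyticAt_cfFamS [NeZero q] (G : CfLip) (ξ₀ : SL(2, ZMod q)) (s : ℂ) : AnalyticAt ℂ (cfFamS q Θ G ξ₀) s :=
  ((cfTwSingle q ξ₀).analyticAt _).comp (Θ.analyticAt_cfPowFam G 2 s)

/-- `s ↦ G_s ⊗ δ_{ξ₀}` is continuous. [folklore] -/
theorem continuous_cfFamS [NeZero q] (G : CfLip) (ξ₀ : SL(2, ZMod q)) : Continuous (cfFamS q Θ G ξ₀) :=
  (cfTwSingle q ξ₀).continuous.comp (Θ.continuous_cfPowFam G 2)

/-- `‖G_s ⊗ δ_{ξ₀}‖ ≤ ‖G_s‖`. [folklore] -/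
theorem norm_cfFamS_le [NeZero q] (G : CfLip) (ξ₀ : SL(2, ZMod q)) (s : ℂ) :
    ‖cfFamS q Θ G ξ₀ s‖ ≤ ‖Θ.cfPowFam G 2 s‖ := by
  refine (pi_norm_le_iff_of_nonneg (norm_nonneg _)).2 fun η => ?_
  rw [cfFamS, cfTwSingle_apply]
  split_ifs
  · exact le_rfl
  · rw [norm_zero]; exact norm_nonneg _

/-- **The fiber sums are the twisted iterates:** `Σ_{w ∈ (A×A)ⁿ} a_w ℓ_w^{-s} = (𝓜_sⁿ (G_s ⊗ δ_{ξ₀}))_ξ(x)`.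
[cite: MageeOhWinter2019, §3.2 (3.4)] -/
theorem sum_fiber_eq_cfTwist_pow (hA : ∀ a ∈ A, 1 ≤ a) {G : CfLip} (hGre : ∀ y : Icc (0 : ℝ) 1, (((G y).re : ℝ) : ℂ) = G y)
    (ξ ξ₀ : SL(2, ZMod q)) (x : Icc (0 : ℝ) 1) (s : ℂ) (n : ℕ) :
    ∑ w : Fin n → A × A, ((cfPWWt A q G ξ ξ₀ x ⟨n, w⟩ : ℝ) : ℂ) * (((cfPWLen A Θ x ⟨n, w⟩ : ℝ)) : ℂ) ^ (-s) =
      (cfTwist A hA q s ^ n) (cfFamS q Θ G ξ₀ s) ξ x := by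
  rw [cfTwist_pow_apply, cfTwistSum_eq_sum A hA q s n _ ξ x.2]
  refine Finset.sum_congr rfl fun w _ => ?_
  set l := List.ofFn w
  have hpt := cfPathPoint_mem A hA l x.2
  have hd : 0 < cfDenom (cfPathMat A l) x := by linarith [one_le_cfDenom_cfPathMat A hA l x.2]
  have hφ := Θ.pos hpt
  simp only [cfPWWt, cfPWLen]
  rw [cfFamS, cfTwSingle_apply]
  by_cases hσ : ξ * cfSigmaWord A q l = ξ₀
  · rw [if_pos hσ, if_pos hσ, one_mul, cpow_neg_sq_mul s _ hd hφ, CfLip.extend_of_mem _ hpt, CfLip.extend_of_mem _ hpt,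
      CfThreshold.cfPowFam, CfLip.mul_apply, CfThreshold.cfPow_apply, ← hGre ⟨_, hpt⟩]
    push_cast
    simp only [Complex.ofReal_re]
    ring
  · rw [if_neg hσ, if_neg hσ]
    simp [CfLip.extend]

/-- Bound for the real fiber sums: `Σ_{w ∈ (A×A)ⁿ} a_w ℓ_w^{-σ} ≤ ‖𝓜_σⁿ‖ ‖G_σ‖`. [folklore] -/
theorem sum_fiber_le_twist [NeZero q] (hA : ∀ a ∈ A, 1 ≤ a) {G : CfLip} (hGre : ∀ y : Icc (0 : ℝ) 1, (((G y).re : ℝ) : ℂ) = G y)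
    (ξ ξ₀ : SL(2, ZMod q)) (x : Icc (0 : ℝ) 1) (σ : ℝ) (n : ℕ) :
    ∑ w : Fin n → A × A, cfPWWt A q G ξ ξ₀ x ⟨n, w⟩ * cfPWLen A Θ x ⟨n, w⟩ ^ (-σ) ≤
      ‖cfTwist A hA q (σ : ℂ) ^ n‖ * ‖Θ.cfPowFam G 2 (σ : ℂ)‖ := by
  have hre : ((∑ w : Fin n → A × A, cfPWWt A q G ξ ξ₀ x ⟨n, w⟩ * cfPWLen A Θ x ⟨n, w⟩ ^ (-σ) : ℝ) : ℂ) =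
      (cfTwist A hA q (σ : ℂ) ^ n) (cfFamS q Θ G ξ₀ (σ : ℂ)) ξ x := by
    rw [← sum_fiber_eq_cfTwist_pow Θ hA hGre ξ ξ₀ x (σ : ℂ) n]
    push_cast
    refine Finset.sum_congr rfl fun w _ => ?_
    rw [ofReal_cpow (by linarith [one_le_cfPWLen hA Θ x.2 ⟨n, w⟩]) (-σ)]
    push_cast
    ring_nf
  have h1 : ∑ w : Fin n → A × A, cfPWWt A q G ξ ξ₀ x ⟨n, w⟩ * cfPWLen A Θ x ⟨n, w⟩ ^ (-σ) ≤
      ‖(cfTwist A hA q (σ : ℂ) ^ n) (cfFamS q Θ G ξ₀ (σ : ℂ)) ξ x‖ := by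
    rw [← hre, Complex.norm_real, Real.norm_eq_abs]
    exact le_abs_self _
  refine h1.trans ((CfLip.norm_apply_le _ x).trans ((norm_le_pi_norm _ ξ).trans ?_))
  exact ((cfTwist A hA q (σ : ℂ) ^ n).le_opNorm _).trans
    (mul_le_mul_of_nonneg_left (norm_cfFamS_le Θ G ξ₀ _) (norm_nonneg _))

/-- **Summability:** `Σ_w a_w ℓ_w^{-σ} < ∞` for `σ > δ_A` (from `Σ_n ‖𝓜_σⁿ‖ < ∞`). [cite: MageeOhWinter2019, §3.2] -/
theorem summable_cfPW [NeZero q] (hA : ∀ a ∈ A, 1 ≤ a) (h2 : 2 ≤ A.card) {G : CfLip} (hGre : ∀ y : Icc (0 : ℝ) 1, (((G y).re : ℝ) : ℂ) = G y)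
    (hG0 : ∀ y : Icc (0 : ℝ) 1, 0 ≤ (G y).re) (ξ ξ₀ : SL(2, ZMod q)) (x : Icc (0 : ℝ) 1) {σ : ℝ}
    (hσ : cfDimension A < σ) :
    Summable fun w : cfPairWords A => cfPWWt A q G ξ ξ₀ x w * cfPWLen A Θ x w ^ (-σ) := by
  have hnn : ∀ w : cfPairWords A, 0 ≤ cfPWWt A q G ξ ξ₀ x w * cfPWLen A Θ x w ^ (-σ) := fun w =>
    mul_nonneg (cfPWWt_nonneg hG0 ξ ξ₀ x w) (rpow_nonneg (by linarith [one_le_cfPWLen hA Θ x.2 w]) _)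
  refine (summable_sigma_of_nonneg hnn).2 ⟨fun n => (hasSum_fintype _).summable, ?_⟩
  have hs : Summable fun n => ‖cfTwist A hA q (σ : ℂ) ^ n‖ * ‖Θ.cfPowFam G 2 (σ : ℂ)‖ :=
    (isUnit_one_sub_cfTwist_of_lt A hA h2 q (by simpa using hσ)).1.mul_right _
  refine Summable.of_nonneg_of_le (fun n => tsum_nonneg fun w => hnn ⟨n, w⟩) (fun n => ?_) hs
  rw [tsum_fintype]
  exact sum_fiber_le_twist Θ hA hGre ξ ξ₀ x σ n

/-- **The weighted count of the family is the congruence count:** `Σ_w a_w 𝟙{ℓ_w ≤ X²} = N_q(X, x; ξ → ξ₀; G, Φ)`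
for `X ≥ 0`. [folklore] -/
theorem countFn_cfPW_eq [NeZero q] (hA : ∀ a ∈ A, 1 ≤ a) (h2 : 2 ≤ A.card) {G : CfLip} (hGre : ∀ y : Icc (0 : ℝ) 1, (((G y).re : ℝ) : ℂ) = G y)
    (hG0 : ∀ y : Icc (0 : ℝ) 1, 0 ≤ (G y).re) (ξ ξ₀ : SL(2, ZMod q)) (x : Icc (0 : ℝ) 1) {X : ℝ} (hX : 0 ≤ X) :
    PerronTwo.countFn (cfPWWt A q G ξ ξ₀ x) (cfPWLen A Θ x) (X ^ 2) = cfCongCountT A Θ G ξ ξ₀ X x := by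
  have hs := summable_cfPW Θ hA h2 hGre hG0 ξ ξ₀ x (σ := cfDimension A + 1) (by linarith)
  have hsum := PerronTwo.summable_indicator (a := cfPWWt A q G ξ ξ₀ x) (ℓ := cfPWLen A Θ x)
    (σ := cfDimension A + 1) (cfPWWt_nonneg hG0 ξ ξ₀ x) (one_le_cfPWLen hA Θ x.2)
    (by linarith [cfDimension_pos hA h2]) hs (X ^ 2)
  rw [PerronTwo.countFn, hsum.tsum_sigma' (fun n => (hasSum_fintype _).summable), cfCongCountT]
  refine tsum_congr fun n => ?_
  rw [tsum_fintype, cfCongLenCountT]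
  refine Finset.sum_congr rfl fun w _ => ?_
  set l := List.ofFn w
  have hpt := cfPathPoint_mem A hA l x.2
  have hd : 0 < cfDenom (cfPathMat A l) x := by linarith [one_le_cfDenom_cfPathMat A hA l x.2]
  have hφ := Θ.pos hpt
  have hpos : 0 < cfDenom (cfPathMat A l) x * Θ.Φ (cfPathPoint A l x) := mul_pos hd hφ
  simp only [cfPWWt, cfPWLen]
  by_cases hle : cfDenom (cfPathMat A l) x * Θ.Φ (cfPathPoint A l x) ≤ X
  · rw [if_pos hle, if_pos ((pow_le_pow_iff_left₀ hpos.le hX two_ne_zero).2 hle)]; ring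
  · rw [if_neg hle, if_neg fun h' => hle ((pow_le_pow_iff_left₀ hpos.le hX two_ne_zero).1 h')]; ring

/-- **The Dirichlet series of the family is the twisted resolvent coefficient:**
`Σ_w a_w ℓ_w^{-s} = Σ_n (𝓜_sⁿ (G_s ⊗ δ_{ξ₀}))_ξ(x) = D(s)` for `Re s > δ_A`. [cite: MageeOhWinter2019, §3.2 (3.4)] -/
theorem dirSeries_cfPW_eq [NeZero q] (hA : ∀ a ∈ A, 1 ≤ a) (h2 : 2 ≤ A.card) {G : CfLip} (hGre : ∀ y : Icc (0 : ℝ) 1, (((G y).re : ℝ) : ℂ) = G y)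
    (hG0 : ∀ y : Icc (0 : ℝ) 1, 0 ≤ (G y).re) (ξ ξ₀ : SL(2, ZMod q)) (x : Icc (0 : ℝ) 1) {s : ℂ}
    (hs : cfDimension A < s.re) :
    PerronTwo.dirSeries (cfPWWt A q G ξ ξ₀ x) (cfPWLen A Θ x) s = cfCongRes q Θ hA G ξ ξ₀ x s := by
  have hsumR := summable_cfPW Θ hA h2 hGre hG0 ξ ξ₀ x hs
  have hsumC : Summable fun w : cfPairWords A =>
      ((cfPWWt A q G ξ ξ₀ x w : ℝ) : ℂ) * (((cfPWLen A Θ x w : ℝ)) : ℂ) ^ (-s) := by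
    refine Summable.of_norm (hsumR.congr fun w => ?_)
    rw [norm_mul, Complex.norm_real, Real.norm_eq_abs, abs_of_nonneg (cfPWWt_nonneg hG0 ξ ξ₀ x w),
      norm_cpow_eq_rpow_re_of_pos (by linarith [one_le_cfPWLen hA Θ x.2 w])]
    simp
  obtain ⟨hsumM, -⟩ := isUnit_one_sub_cfTwist_of_lt A hA h2 q hs
  have hev : ∑' n, (cfTwist A hA q s ^ n) (cfFamS q Θ G ξ₀ s) ξ x = cfCongRes q Θ hA G ξ ξ₀ x s := by
    rw [cfCongRes, inverse_one_sub_eq_tsum hsumM]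
    have h := ((CfLip.eval x).comp ((ContinuousLinearMap.proj ξ).comp
      (ContinuousLinearMap.apply ℂ (SL(2, ZMod q) → CfLip) (cfFamS q Θ G ξ₀ s)))).map_tsum hsumM.of_norm
    simp only [ContinuousLinearMap.coe_comp, Function.comp_apply, ContinuousLinearMap.apply_apply,
      ContinuousLinearMap.proj_apply, CfLip.eval_apply] at h
    exact h.symm
  rw [PerronTwo.dirSeries, hsumC.tsum_sigma' (fun n => (hasSum_fintype _).summable), ← hev]
  refine tsum_congr fun n => ?_
  rw [tsum_fintype, sum_fiber_eq_cfTwist_pow Θ hA hGre ξ ξ₀ x s n]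

end Family

/-! ### The residue, the singular part and the regular part -/

section Regular

variable (q : ℕ) [NeZero q] (Θ : CfThreshold) (hA : ∀ a ∈ A, 1 ≤ a) (h2 : 2 ≤ A.card)

/-- The residue of `D` at `δ_A`: `r = |Γ_q|^{-1} · ½ ν(G Φ^{-2δ_A}) h(x)/κ_A` (`= |Γ_q|^{-1} δ_A c_{G,Φ}(x)`).
[cite: MageeOhWinter2019, Lemma 16 and Thm. 11] -/
def cfCongResid (G : CfLip) (x : Icc (0 : ℝ) 1) : ℝ :=
  ((Fintype.card (SL(2, ZMod q)) : ℝ))⁻¹ *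
    (1 / 2 * cfInt (cfNuδ A hA h2) (fun y => (G.extend y).re * Θ.Φ y ^ (-(2 * cfDimension A))) * cfHδ A hA h2 x /
      cfInt (cfNuδ A hA h2) (cfG A hA h2))

/-- `r = |Γ_q|^{-1} δ_A c_{G,Φ}(x)`. [folklore] -/
theorem cfCongResid_eq (G : CfLip) (x : Icc (0 : ℝ) 1) :
    cfCongResid q Θ hA h2 G x =
      ((Fintype.card (SL(2, ZMod q)) : ℝ))⁻¹ * (cfDimension A * cfEvenConst A hA h2 Θ G x) := by
  have hδ := (cfDimension_pos hA h2).ne'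
  have hκ := (cfInt_cfG_pos A hA h2).ne'
  rw [cfCongResid, cfEvenConst]
  congr 1
  field_simp

/-- `r ≥ 0` for `G ≥ 0`. [folklore] -/
theorem cfCongResid_nonneg {G : CfLip} (hG0 : ∀ y : Icc (0 : ℝ) 1, 0 ≤ (G y).re) (x : Icc (0 : ℝ) 1) :
    0 ≤ cfCongResid q Θ hA h2 G x := by
  refine mul_nonneg (by positivity) (div_nonneg (mul_nonneg (mul_nonneg (by norm_num) ?_) (cfHδ_pos A hA h2 x.2).le)
    (cfInt_cfG_pos A hA h2).le)
  refine MeasureTheory.integral_nonneg fun y => mul_nonneg ?_ (rpow_nonneg (Θ.pos y.2).le _)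
  rw [CfLip.extend_coe]; exact hG0 y

/-- The singular part removed: `f(s) = D(s) − r/(s − δ_A)`. [cite: MageeOhWinter2019, §3.4] -/
def cfCongSub (G : CfLip) (ξ ξ₀ : SL(2, ZMod q)) (x : Icc (0 : ℝ) 1) (s : ℂ) : ℂ :=
  cfCongRes q Θ hA G ξ ξ₀ x s - (cfCongResid q Θ hA h2 G x : ℂ) / (s - cfDimension A)

/-- **The regular part** `H = f` with its removable singularity at `δ_A` filled in. [cite: MageeOhWinter2019, §3.4] -/
def cfCongReg (G : CfLip) (ξ ξ₀ : SL(2, ZMod q)) (x : Icc (0 : ℝ) 1) : ℂ → ℂ :=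
  Function.update (cfCongSub q Θ hA h2 G ξ ξ₀ x) (cfDimension A : ℂ)
    (limUnder (𝓝[≠] (cfDimension A : ℂ)) (cfCongSub q Θ hA h2 G ξ ξ₀ x))

/-- Off `δ_A`, `H = D − r/(s − δ_A)`. [folklore] -/
theorem cfCongReg_of_ne (G : CfLip) (ξ ξ₀ : SL(2, ZMod q)) (x : Icc (0 : ℝ) 1) {s : ℂ} (hs : s ≠ (cfDimension A : ℂ)) :
    cfCongReg q Θ hA h2 G ξ ξ₀ x s = cfCongRes q Θ hA G ξ ξ₀ x s - (cfCongResid q Θ hA h2 G x : ℂ) / (s - cfDimension A) := by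
  rw [cfCongReg, Function.update_of_ne hs, cfCongSub]

/-! ### Units and analyticity off the pole -/

omit [NeZero q] in
/-- `1 − L_s² = (1 − L_s)(1 + L_s)` is a unit when both factors are, and its inverse is the product of theirs.
[folklore] -/
theorem inverse_one_sub_cfLOp_sq {s : ℂ} (h1 : IsUnit (1 - cfLOp A hA s)) (h1' : IsUnit (1 + cfLOp A hA s)) :
    IsUnit (1 - cfLOp A hA s ^ 2) ∧
      Ring.inverse (1 - cfLOp A hA s ^ 2) = Ring.inverse (1 + cfLOp A hA s) * Ring.inverse (1 - cfLOp A hA s) := by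
  have hfac : 1 - cfLOp A hA s ^ 2 = (1 - cfLOp A hA s) * (1 + cfLOp A hA s) := by
    rw [sq, mul_add, sub_mul, sub_mul, one_mul, mul_one, one_mul]; abel
  obtain ⟨u, hu⟩ := h1
  obtain ⟨v, hv⟩ := h1'
  rw [hfac, ← hu, ← hv, ← Units.val_mul, Ring.inverse_unit, Ring.inverse_unit, Ring.inverse_unit, mul_inv_rev,
    Units.val_mul]
  exact ⟨u.isUnit.mul v.isUnit, rfl⟩

/-- `D` is analytic at every `s` where `1 − 𝓜_s` is a unit. [folklore] -/
theorem analyticAt_cfCongRes (G : CfLip) (ξ ξ₀ : SL(2, ZMod q)) (x : Icc (0 : ℝ) 1) {s : ℂ}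
    (hM : IsUnit (1 - cfTwist A hA q s)) : AnalyticAt ℂ (cfCongRes q Θ hA G ξ ξ₀ x) s := by
  have hT : AnalyticAt ℂ (fun s => Ring.inverse (1 - cfTwist A hA q s)) s :=
    analyticAt_ring_inverse (analyticAt_const.sub (analyticAt_cfTwist A hA q s)) hM
  have h := analyticAt_clm_apply hT (analyticAt_cfFamS Θ G ξ₀ s)
  have h' := (((CfLip.eval x).comp (ContinuousLinearMap.proj (R := ℂ) (φ := fun _ : SL(2, ZMod q) => CfLip) ξ)).analyticAt
    _).comp h
  have heq : cfCongRes q Θ hA G ξ ξ₀ x = (⇑((CfLip.eval x).comp (ContinuousLinearMap.proj (R := ℂ)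
      (φ := fun _ : SL(2, ZMod q) => CfLip) ξ))) ∘ fun s => Ring.inverse (1 - cfTwist A hA q s) (cfFamS q Θ G ξ₀ s) := by
    funext s; rfl
  rw [heq]; exact h'

/-- `f` is analytic at every `s ≠ δ_A` where `1 − 𝓜_s` is a unit. [folklore] -/
theorem analyticAt_cfCongSub (G : CfLip) (ξ ξ₀ : SL(2, ZMod q)) (x : Icc (0 : ℝ) 1) {s : ℂ}
    (hM : IsUnit (1 - cfTwist A hA q s)) (hne : s ≠ (cfDimension A : ℂ)) :
    AnalyticAt ℂ (cfCongSub q Θ hA h2 G ξ ξ₀ x) s := by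
  refine (analyticAt_cfCongRes q Θ hA G ξ ξ₀ x hM).sub ?_
  exact analyticAt_const.div (analyticAt_id.sub analyticAt_const) (sub_ne_zero.2 hne)

/-! ### The decomposition of `D` near `δ_A` -/

/-- **`D` near `δ_A`:** there are `ε > 0` and an analytic `W` (the regular part `W_reg` of `(1 − L_s)^{-1}`) such
that for `s` in the punctured disc where `1 + L_s` and `1 − B_s` are units, `1 − 𝓜_s` is a unit and
`D(s) = |Γ_q|^{-1} ((1+L_s)^{-1} W(s) G_s)(x) + (s−δ_A)^{-1} |Γ_q|^{-1} κ_A^{-1} ν(G_s) ((1+L_s)^{-1} h)(x)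
 + ((1−B_s)^{-1} P₁ (G_s ⊗ δ_{ξ₀}))_ξ(x)`. [cite: MageeOhWinter2019, §3.2 and Lemma 16] -/
theorem cfCongRes_decomp (G : CfLip) (ξ ξ₀ : SL(2, ZMod q)) (x : Icc (0 : ℝ) 1) :
    ∃ ε > 0, ∃ W : ℂ → (CfLip →L[ℂ] CfLip), (∀ s ∈ ball (cfDimension A : ℂ) ε, AnalyticAt ℂ W s) ∧
      ∀ s ∈ ball (cfDimension A : ℂ) ε, s ≠ (cfDimension A : ℂ) → IsUnit (1 + cfLOp A hA s) →
        IsUnit (1 - cfTwB A hA q s) →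
        IsUnit (1 - cfTwist A hA q s) ∧
        cfCongRes q Θ hA G ξ ξ₀ x s =
          ((Fintype.card (SL(2, ZMod q)) : ℂ))⁻¹ * (Ring.inverse (1 + cfLOp A hA s) (W s (Θ.cfPowFam G 2 s))) x +
          (s - cfDimension A)⁻¹ * (((Fintype.card (SL(2, ZMod q)) : ℂ))⁻¹ *
            ((cfInt (cfNuδ A hA h2) (cfG A hA h2) : ℝ) : ℂ)⁻¹ * cfNuL A hA h2 (Θ.cfPowFam G 2 s) *
              (Ring.inverse (1 + cfLOp A hA s) (cfHL A hA h2)) x) +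
          ((Ring.inverse (1 - cfTwB A hA q s) * cfTwP1 q) (cfFamS q Θ G ξ₀ s)) ξ x := by
  obtain ⟨ε, hε, Wreg, han, hinv⟩ := cfResolvent_pole' A hA h2
  refine ⟨ε, hε, Wreg, han, fun s hs hne hL2 hB => ?_⟩
  obtain ⟨hl, hr⟩ := hinv s hs hne
  set c : ℂ := (s - cfDimension A)⁻¹ * ((cfInt (cfNuδ A hA h2) (cfG A hA h2) : ℝ) : ℂ)⁻¹ with hc
  -- `1 - L_s` is a unit with inverse `W' = Wreg s + c • Π`
  set u : (CfLip →L[ℂ] CfLip)ˣ := ⟨_, _, hl, hr⟩ with hu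
  have hL1 : IsUnit (1 - cfLOp A hA s) := ⟨u, rfl⟩
  have hinvL : Ring.inverse (1 - cfLOp A hA s) = Wreg s + c • cfPi A hA h2 := Ring.inverse_unit u
  obtain ⟨hL, hLinv⟩ := inverse_one_sub_cfLOp_sq hA hL1 hL2
  obtain ⟨hMu, hMeq⟩ := cfTwist_inverse_eq A hA q hL hB
  refine ⟨hMu, ?_⟩
  have hmulapp : ∀ (P Q : CfLip →L[ℂ] CfLip) (F : CfLip), (P * Q) F = P (Q F) := fun _ _ _ => rfl
  rw [cfCongRes, hMeq, _root_.add_apply, Pi.add_apply, CfLip.add_apply, cfTwLift_apply, cfFamS, cfTwAv_cfTwSingle,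
    map_smul, CfLip.smul_apply, hLinv, hmulapp, hinvL,
    show ∀ (P Q : CfLip →L[ℂ] CfLip) (F : CfLip), (P + Q) F = P F + Q F from fun _ _ _ => rfl,
    show ∀ (c : ℂ) (P : CfLip →L[ℂ] CfLip) (F : CfLip), (c • P) F = c • P F from fun _ _ _ => rfl,
    cfPi_apply, smul_smul, map_add, map_smul, CfLip.add_apply, CfLip.smul_apply, ← cfFamS]
  simp only [hc]
  ring

/-! ### Holomorphy of the regular part (removable singularity) -/

/-- **Boundedness of `f` near `δ_A`:** if `1 + L_s`, `1 − B_s` are units near `δ_A`, then `f = D − r/(s−δ_A)` is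
bounded on a punctured disc around `δ_A` (`f = A(s) + (ψ(s) − ψ(δ_A))/(s − δ_A)` with `A` continuous and `ψ`
differentiable at `δ_A`, `ψ(δ_A) = r`). [cite: MageeOhWinter2019, Lemma 16] -/
theorem exists_bound_cfCongSub {G : CfLip} (hGre : ∀ y : Icc (0 : ℝ) 1, (((G y).re : ℝ) : ℂ) = G y)
    (ξ ξ₀ : SL(2, ZMod q)) (x : Icc (0 : ℝ) 1) {σ₀ : ℝ} (hσ₀δ : σ₀ < cfDimension A)
    (hL2 : ∀ s : ℂ, σ₀ < s.re → IsUnit (1 + cfLOp A hA s))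
    (hB : ∀ s : ℂ, σ₀ < s.re → IsUnit (1 - cfTwB A hA q s)) :
    ∃ ρ > 0, ∃ K : ℝ, ∀ s ∈ ball (cfDimension A : ℂ) ρ, s ≠ (cfDimension A : ℂ) →
      ‖cfCongSub q Θ hA h2 G ξ ξ₀ x s‖ ≤ K := by
  set δ : ℂ := (cfDimension A : ℂ) with hδdef
  have hδU : σ₀ < δ.re := by simpa [hδdef] using hσ₀δ
  obtain ⟨ε, hε, W, hWan, hdec⟩ := cfCongRes_decomp q Θ hA h2 G ξ ξ₀ x
  set card : ℂ := ((Fintype.card (SL(2, ZMod q)) : ℂ)) with hcard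
  set κ : ℂ := ((cfInt (cfNuδ A hA h2) (cfG A hA h2) : ℝ) : ℂ) with hκ
  -- the continuous part `A`
  set Afun : ℂ → ℂ := fun s => card⁻¹ * (Ring.inverse (1 + cfLOp A hA s) (W s (Θ.cfPowFam G 2 s))) x +
    ((Ring.inverse (1 - cfTwB A hA q s) * cfTwP1 q) (cfFamS q Θ G ξ₀ s)) ξ x with hAfun
  -- the differentiable part `ψ`
  set ψ : ℂ → ℂ := fun s => card⁻¹ * κ⁻¹ * cfNuL A hA h2 (Θ.cfPowFam G 2 s) *
    (Ring.inverse (1 + cfLOp A hA s) (cfHL A hA h2)) x with hψ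
  -- (1) continuity of `A` at `δ`
  have hWc : ContinuousAt W δ := (hWan δ (mem_ball_self hε)).continuousAt
  have hGc : ContinuousAt (Θ.cfPowFam G 2) δ := (Θ.continuous_cfPowFam G 2).continuousAt
  have hinvL : ContinuousAt (fun s => Ring.inverse (1 + cfLOp A hA s)) δ :=
    continuousAt_inverse_one_add_cfLOp A hA h2 (by simp [hδdef])
  have hinvB : ContinuousAt (fun s => Ring.inverse (1 - cfTwB A hA q s) * cfTwP1 q) δ :=
    (continuousAt_inverse_one_sub_cfTwB A hA q (hB δ hδU)).mul continuousAt_const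
  have hFc : ContinuousAt (cfFamS q Θ G ξ₀) δ := (continuous_cfFamS Θ G ξ₀).continuousAt
  have hAc : ContinuousAt Afun δ := by
    have h1 : ContinuousAt (fun s => Ring.inverse (1 + cfLOp A hA s) (W s (Θ.cfPowFam G 2 s))) δ :=
      hinvL.clm_apply (hWc.clm_apply hGc)
    have h1' : ContinuousAt (fun s => (Ring.inverse (1 + cfLOp A hA s) (W s (Θ.cfPowFam G 2 s))) x) δ :=
      ((CfLip.eval x).continuous.continuousAt).comp h1
    have h2' : ContinuousAt (fun s => (Ring.inverse (1 - cfTwB A hA q s) * cfTwP1 q) (cfFamS q Θ G ξ₀ s)) δ :=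
      hinvB.clm_apply hFc
    have h2'' : ContinuousAt (fun s => ((Ring.inverse (1 - cfTwB A hA q s) * cfTwP1 q) (cfFamS q Θ G ξ₀ s)) ξ x) δ :=
      ((CfLip.eval x).comp (ContinuousLinearMap.proj (R := ℂ) (φ := fun _ : SL(2, ZMod q) => CfLip) ξ)
        ).continuous.continuousAt.comp h2'
    exact (continuousAt_const.mul h1').add h2''
  -- (2) differentiability of `ψ` at `δ`
  have hψd : DifferentiableAt ℂ ψ δ := by
    have h1 : DifferentiableAt ℂ (fun s => cfNuL A hA h2 (Θ.cfPowFam G 2 s)) δ :=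
      Θ.differentiableAt_cfNuL_cfPowFam hA h2 G 2 δ
    have h2a : AnalyticAt ℂ (fun s => Ring.inverse (1 + cfLOp A hA s)) δ :=
      analyticAt_ring_inverse (analyticAt_const.add (analyticAt_cfLOp A hA δ)) (hL2 δ hδU)
    have h2b : AnalyticAt ℂ (fun s => Ring.inverse (1 + cfLOp A hA s) (cfHL A hA h2)) δ :=
      analyticAt_clm_apply h2a analyticAt_const
    have h2c : AnalyticAt ℂ (fun s => (Ring.inverse (1 + cfLOp A hA s) (cfHL A hA h2)) x) δ :=
      ((CfLip.eval x).analyticAt _).comp h2b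
    exact ((differentiableAt_const _).mul h1).mul h2c.differentiableAt
  have hcard0 : card ≠ 0 := by rw [hcard]; exact_mod_cast Fintype.card_ne_zero
  have hκ0 : κ ≠ 0 := by rw [hκ]; exact ofReal_ne_zero.2 (cfInt_cfG_pos A hA h2).ne'
  -- (3) `ψ δ = r`
  have hψδ : ψ δ = (cfCongResid q Θ hA h2 G x : ℂ) := by
    have hu2 := hL2 δ hδU
    have honeapp : ∀ F : CfLip, (1 : CfLip →L[ℂ] CfLip) F = F := fun _ => rfl
    have h2h : (1 + cfLOp A hA δ) ((1 / 2 : ℂ) • cfHL A hA h2) = cfHL A hA h2 := by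
      rw [map_smul, show ∀ (P Q : CfLip →L[ℂ] CfLip) (F : CfLip), (P + Q) F = P F + Q F from fun _ _ _ => rfl,
        honeapp, hδdef, cfLOp_cfHL A hA h2, ← two_smul ℂ (cfHL A hA h2), smul_smul,
        show (1 / 2 : ℂ) * 2 = 1 by norm_num, one_smul]
    have hh : Ring.inverse (1 + cfLOp A hA δ) (cfHL A hA h2) = (1 / 2 : ℂ) • cfHL A hA h2 := by
      have e : Ring.inverse (1 + cfLOp A hA δ) (cfHL A hA h2) =
          (Ring.inverse (1 + cfLOp A hA δ) * (1 + cfLOp A hA δ)) ((1 / 2 : ℂ) • cfHL A hA h2) := by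
        conv_lhs => rw [← h2h]
        rfl
      rw [e, Ring.inverse_mul_cancel _ hu2, honeapp]
    have hν : cfNuL A hA h2 (Θ.cfPowFam G 2 δ) =
        ((cfInt (cfNuδ A hA h2) (fun y => (G.extend y).re * Θ.Φ y ^ (-(2 * cfDimension A))) : ℝ) : ℂ) := by
      refine cfNuL_of_real A hA h2 (g := fun y => (G.extend y).re * Θ.Φ y ^ (-(2 * cfDimension A))) fun y => ?_
      rw [hδdef, Θ.cfPowFam_ofReal hGre 2 (cfDimension A) y, CfLip.extend_coe]
    simp only [hψ]
    rw [hh, hν, CfLip.smul_apply, cfHL_apply, cfCongResid]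
    simp only [hcard, hκ]
    push_cast
    field_simp
  -- (4) the identity `f = A + slope ψ δ` near `δ`, and the bound
  have hU : {s : ℂ | σ₀ < s.re} ∈ 𝓝 δ := (isOpen_lt continuous_const continuous_re).mem_nhds hδU
  have hreg : ∀ᶠ s in 𝓝[≠] δ, cfCongSub q Θ hA h2 G ξ ξ₀ x s = Afun s + slope ψ δ s := by
    have h1 : ∀ᶠ s in 𝓝[≠] δ, s ∈ ball δ ε ∩ {s : ℂ | σ₀ < s.re} ∧ s ≠ δ := by
      refine (eventually_nhdsWithin_iff.2 ?_)
      filter_upwards [inter_mem (ball_mem_nhds δ hε) hU] with s hs hne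
      exact ⟨hs, hne⟩
    filter_upwards [h1] with s hs
    obtain ⟨⟨hsb, hsU⟩, hne⟩ := hs
    obtain ⟨-, heq⟩ := hdec s hsb hne (hL2 s hsU) (hB s hsU)
    have hsδ : (s - (cfDimension A : ℂ)) ≠ 0 := sub_ne_zero.2 hne
    rw [cfCongSub, heq, slope_def_field, hψδ]
    simp only [hAfun, hψ, hδdef]
    rw [div_eq_mul_inv _ (s - (cfDimension A : ℂ)), div_eq_mul_inv _ (s - (cfDimension A : ℂ))]
    ring
  have hAb : ∀ᶠ s in 𝓝[≠] δ, ‖Afun s‖ < ‖Afun δ‖ + 1 :=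
    mem_nhdsWithin_of_mem_nhds (hAc.norm (Iio_mem_nhds (lt_add_one _)))
  have hψb : ∀ᶠ s in 𝓝[≠] δ, ‖slope ψ δ s‖ < ‖deriv ψ δ‖ + 1 :=
    (hψd.hasDerivAt.tendsto_slope).norm (Iio_mem_nhds (lt_add_one _))
  have hev : ∀ᶠ s in 𝓝[≠] δ, ‖cfCongSub q Θ hA h2 G ξ ξ₀ x s‖ ≤ ‖Afun δ‖ + 1 + (‖deriv ψ δ‖ + 1) := by
    filter_upwards [hreg, hAb, hψb] with s h1 h2' h3
    rw [h1]
    exact (norm_add_le _ _).trans (by linarith)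
  obtain ⟨ρ, hρ, hsub⟩ := Metric.mem_nhdsWithin_iff.1 hev
  refine ⟨ρ, hρ, ‖Afun δ‖ + 1 + (‖deriv ψ δ‖ + 1), fun s hs hne => ?_⟩
  exact hsub ⟨hs, hne⟩

/-- **`H` is holomorphic on `Re s > σ₀`** under the unit hypotheses (analytic off `δ_A` as a twisted-resolvent
coefficient; removable singularity at `δ_A`). [cite: MageeOhWinter2019, §3.4] -/
theorem differentiableOn_cfCongReg {G : CfLip} (hGre : ∀ y : Icc (0 : ℝ) 1, (((G y).re : ℝ) : ℂ) = G y)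
    (ξ ξ₀ : SL(2, ZMod q)) (x : Icc (0 : ℝ) 1) {σ₀ : ℝ} (hσ₀δ : σ₀ < cfDimension A)
    (hL1 : ∀ s : ℂ, σ₀ < s.re → s ≠ (cfDimension A : ℂ) → IsUnit (1 - cfLOp A hA s))
    (hL2 : ∀ s : ℂ, σ₀ < s.re → IsUnit (1 + cfLOp A hA s))
    (hB : ∀ s : ℂ, σ₀ < s.re → IsUnit (1 - cfTwB A hA q s)) :
    DifferentiableOn ℂ (cfCongReg q Θ hA h2 G ξ ξ₀ x) {s : ℂ | σ₀ < s.re} := by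
  have hM : ∀ s : ℂ, σ₀ < s.re → s ≠ (cfDimension A : ℂ) → IsUnit (1 - cfTwist A hA q s) := fun s hs hne =>
    (cfTwist_inverse_eq A hA q (inverse_one_sub_cfLOp_sq hA (hL1 s hs hne) (hL2 s hs)).1 (hB s hs)).1
  obtain ⟨ρ₀, hρ₀, K, hK⟩ := exists_bound_cfCongSub q Θ hA h2 hGre ξ ξ₀ x hσ₀δ hL2 hB
  -- a small ball inside the half-plane and inside the bounded region
  obtain ⟨ρ, hρ, hρsub⟩ : ∃ ρ > 0, ball (cfDimension A : ℂ) ρ ⊆ ball (cfDimension A : ℂ) ρ₀ ∩ {s : ℂ | σ₀ < s.re} := by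
    refine Metric.mem_nhds_iff.1 (inter_mem (ball_mem_nhds _ hρ₀) ?_)
    exact (isOpen_lt continuous_const continuous_re).mem_nhds (by simpa using hσ₀δ)
  have hball : DifferentiableOn ℂ (cfCongReg q Θ hA h2 G ξ ξ₀ x) (ball (cfDimension A : ℂ) ρ) := by
    refine differentiableOn_update_limUnder_of_bddAbove (ball_mem_nhds _ hρ) ?_ ?_
    · intro s hs
      have hs' := hρsub hs.1
      have hne : s ≠ (cfDimension A : ℂ) := hs.2
      exact (analyticAt_cfCongSub q Θ hA h2 G ξ ξ₀ x (hM s hs'.2 hne) hne).differentiableAt.differentiableWithinAt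
    · refine ⟨K, ?_⟩
      rintro _ ⟨s, hs, rfl⟩
      exact hK s (hρsub hs.1).1 hs.2
  intro s hs
  by_cases hsδ : s = (cfDimension A : ℂ)
  · rw [hsδ]
    exact (hball.differentiableAt (ball_mem_nhds _ hρ)).differentiableWithinAt
  · have hev : cfCongReg q Θ hA h2 G ξ ξ₀ x =ᶠ[𝓝 s] cfCongSub q Θ hA h2 G ξ ξ₀ x := by
      filter_upwards [isOpen_ne.mem_nhds hsδ] with z hz
      exact Function.update_of_ne hz _ _
    have hd : DifferentiableAt ℂ (cfCongSub q Θ hA h2 G ξ ξ₀ x) s :=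
      (analyticAt_cfCongSub q Θ hA h2 G ξ ξ₀ x (hM s hs hsδ) hsδ).differentiableAt
    exact (hd.congr_of_eventuallyEq hev).differentiableWithinAt

/-- **The bound at the pole point passes to the limit:** if `‖f(δ_A + it)‖ ≤ M(1+|t|)^κ` for `t ≠ 0`, then
`‖H(δ_A)‖ ≤ M`. [folklore] -/
theorem norm_cfCongReg_delta_le {G : CfLip} (hGre : ∀ y : Icc (0 : ℝ) 1, (((G y).re : ℝ) : ℂ) = G y)
    (ξ ξ₀ : SL(2, ZMod q)) (x : Icc (0 : ℝ) 1) {σ₀ : ℝ} (hσ₀δ : σ₀ < cfDimension A)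
    (hL1 : ∀ s : ℂ, σ₀ < s.re → s ≠ (cfDimension A : ℂ) → IsUnit (1 - cfLOp A hA s))
    (hL2 : ∀ s : ℂ, σ₀ < s.re → IsUnit (1 + cfLOp A hA s))
    (hB : ∀ s : ℂ, σ₀ < s.re → IsUnit (1 - cfTwB A hA q s)) {M κ : ℝ}
    (hb : ∀ t : ℝ, t ≠ 0 → ‖cfCongSub q Θ hA h2 G ξ ξ₀ x ((cfDimension A : ℂ) + t * I)‖ ≤ M * (1 + |t|) ^ κ) :
    ‖cfCongReg q Θ hA h2 G ξ ξ₀ x (cfDimension A : ℂ)‖ ≤ M := by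
  have hdiff := differentiableOn_cfCongReg q Θ hA h2 hGre ξ ξ₀ x hσ₀δ hL1 hL2 hB
  have hmem : {s : ℂ | σ₀ < s.re} ∈ 𝓝 (cfDimension A : ℂ) :=
    (isOpen_lt continuous_const continuous_re).mem_nhds (by simpa using hσ₀δ)
  have hcont : ContinuousAt (cfCongReg q Θ hA h2 G ξ ξ₀ x) (cfDimension A : ℂ) :=
    (hdiff.differentiableAt hmem).continuousAt
  have hline : Tendsto (fun t : ℝ => (cfDimension A : ℂ) + t * I) (𝓝[≠] 0) (𝓝 (cfDimension A : ℂ)) := by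
    have h : Continuous fun t : ℝ => (cfDimension A : ℂ) + t * I := by fun_prop
    have h0 := h.tendsto 0
    simp only [ofReal_zero, zero_mul, add_zero] at h0
    exact h0.mono_left nhdsWithin_le_nhds
  have h1 : Tendsto (fun t : ℝ => ‖cfCongReg q Θ hA h2 G ξ ξ₀ x ((cfDimension A : ℂ) + t * I)‖) (𝓝[≠] 0)
      (𝓝 ‖cfCongReg q Θ hA h2 G ξ ξ₀ x (cfDimension A : ℂ)‖) := (hcont.tendsto.comp hline).norm
  have h2' : Tendsto (fun t : ℝ => M * (1 + |t|) ^ κ) (𝓝[≠] 0) (𝓝 M) := by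
    have h : ContinuousAt (fun t : ℝ => M * (1 + |t|) ^ κ) 0 :=
      continuousAt_const.mul (ContinuousAt.rpow_const (by fun_prop) (Or.inl (by norm_num)))
    have h0 := h.tendsto
    simp only [abs_zero, add_zero, Real.one_rpow, mul_one] at h0
    exact h0.mono_left nhdsWithin_le_nhds
  refine le_of_tendsto_of_tendsto h1 h2' ?_
  filter_upwards [self_mem_nhdsWithin] with t ht
  have hne : (cfDimension A : ℂ) + t * I ≠ (cfDimension A : ℂ) := by
    intro h
    apply ht
    have := congrArg Complex.im h
    simpa using this
  rw [cfCongReg, Function.update_of_ne hne]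
  exact hb t ht

/-! ### The theorem -/

/-- **Power saving for the congruence renewal count from finite-order twisted-resolvent bounds.** Fix a level `q`,
a threshold `Φ` (`Θ`), `G ∈ CfLip` real `≥ 0`, fibres `ξ, ξ₀`, `x ∈ [0,1]`, `0 ≤ σ₀ < σ₁ < δ_A`. Assume for all `s`
with `Re s > σ₀`: `1 − L_s` is a unit if `s ≠ δ_A`, `1 + L_s` is a unit, and `1 − B_s` is a unit (`B_s = 𝓜_s P₁`);
and assume the finite-order bound `‖D(u+it) − r/(u+it−δ_A)‖ ≤ M(1+|t|)^κ` for `σ₁ ≤ u ≤ δ_A+1`, `u + it ≠ δ_A`,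
where `D(s) = ((1 − 𝓜_s)^{-1}(G_s ⊗ δ_{ξ₀}))_ξ(x)` (`cfCongRes`), `r = |Γ_q|^{-1}·½ν(GΦ^{-2δ_A})h(x)/κ_A`
(`cfCongResid`), `κ < 2`. Then for every `X ≥ √2`,
`|N_q(X, x; ξ → ξ₀; G, Φ) − r X^{2δ_A}/δ_A| ≤ (r(2^{δ_A+1} + 1/δ_A) + M·(32/π)·2^{2+σ₁}·S(σ₁,κ)) · X^{2δ_A − 2(δ_A−σ₁)/3}`:
the error term of [MageeOhWinter2019, Thm. 11 / Prop. 17] at level `q` GIVEN the spectral input of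
[MageeOhWinter2019, Thm. 4] in resolvent form, with a constant linear in `r` and `M`.
[cite: MageeOhWinter2019, §3.4 Lemma 15, Lemma 16 and Prop. 17] -/
theorem cfCongCountT_powerSaving_of_resolventBound {G : CfLip}
    (hGre : ∀ y : Icc (0 : ℝ) 1, (((G y).re : ℝ) : ℂ) = G y) (hG0 : ∀ y : Icc (0 : ℝ) 1, 0 ≤ (G y).re)
    (ξ ξ₀ : SL(2, ZMod q)) (x : Icc (0 : ℝ) 1) {σ₀ σ₁ : ℝ} (hσ₀ : 0 ≤ σ₀) (hσ₀₁ : σ₀ < σ₁) (hσ₁ : σ₁ < cfDimension A)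
    (hL1 : ∀ s : ℂ, σ₀ < s.re → s ≠ (cfDimension A : ℂ) → IsUnit (1 - cfLOp A hA s))
    (hL2 : ∀ s : ℂ, σ₀ < s.re → IsUnit (1 + cfLOp A hA s))
    (hB : ∀ s : ℂ, σ₀ < s.re → IsUnit (1 - cfTwB A hA q s))
    {κ M : ℝ} (hκ : κ < 2) (hM : 0 ≤ M)
    (hbound : ∀ u : ℝ, σ₁ ≤ u → u ≤ cfDimension A + 1 → ∀ t : ℝ, (u : ℂ) + t * I ≠ (cfDimension A : ℂ) →
      ‖cfCongRes q Θ hA G ξ ξ₀ x ((u : ℂ) + t * I) -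
          (cfCongResid q Θ hA h2 G x : ℂ) / (((u : ℂ) + t * I) - cfDimension A)‖ ≤ M * (1 + |t|) ^ κ)
    {X : ℝ} (hX : Real.sqrt 2 ≤ X) :
    |cfCongCountT A Θ G ξ ξ₀ X x - cfCongResid q Θ hA h2 G x * X ^ (2 * cfDimension A) / cfDimension A| ≤
      (cfCongResid q Θ hA h2 G x * (2 ^ (cfDimension A + 1) + 1 / cfDimension A) +
          M * (32 / π * 2 ^ (2 + σ₁) * PerronTwo.shiftConst σ₁ κ)) *
        X ^ (2 * cfDimension A - 2 * ((cfDimension A - σ₁) / 3)) := by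
  have hδ := cfDimension_pos hA h2
  have hσ₀δ : σ₀ < cfDimension A := hσ₀₁.trans hσ₁
  have hR0 : 0 ≤ X := (Real.sqrt_nonneg 2).trans hX
  have hx2 : 2 ≤ X ^ 2 := by
    have h := pow_le_pow_left₀ (Real.sqrt_nonneg 2) hX 2
    rwa [Real.sq_sqrt (by norm_num)] at h
  have hH := differentiableOn_cfCongReg q Θ hA h2 hGre ξ ξ₀ x hσ₀δ hL1 hL2 hB
  have hD : ∀ s : ℂ, cfDimension A < s.re →
      PerronTwo.dirSeries (cfPWWt A q G ξ ξ₀ x) (cfPWLen A Θ x) s =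
        (cfCongResid q Θ hA h2 G x : ℂ) / (s - cfDimension A) + cfCongReg q Θ hA h2 G ξ ξ₀ x s := by
    intro s hs
    have hne : s ≠ (cfDimension A : ℂ) := by
      intro h; rw [h] at hs; simp at hs
    rw [dirSeries_cfPW_eq Θ hA h2 hGre hG0 ξ ξ₀ x hs, cfCongReg_of_ne q Θ hA h2 G ξ ξ₀ x hne]
    ring
  have hHb : ∀ u : ℝ, σ₁ ≤ u → u ≤ cfDimension A + 1 → ∀ t : ℝ,
      ‖cfCongReg q Θ hA h2 G ξ ξ₀ x ((u : ℂ) + t * I)‖ ≤ M * (1 + |t|) ^ κ := by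
    intro u hu1 hu2 t
    by_cases hst : (u : ℂ) + t * I = (cfDimension A : ℂ)
    · have ht : t = 0 := by have := congrArg Complex.im hst; simpa using this
      rw [hst, ht, abs_zero, add_zero, Real.one_rpow, mul_one]
      refine norm_cfCongReg_delta_le q Θ hA h2 hGre ξ ξ₀ x hσ₀δ hL1 hL2 hB (κ := κ) fun t' ht' => ?_
      have hne : (cfDimension A : ℂ) + t' * I ≠ (cfDimension A : ℂ) := by
        intro h; apply ht'; have := congrArg Complex.im h; simpa using this
      have h := hbound (cfDimension A) hσ₁.le (by linarith) t' hne
      rwa [cfCongSub]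
    · rw [cfCongReg_of_ne q Θ hA h2 G ξ ξ₀ x hst]
      exact hbound u hu1 hu2 t hst
  have hmain := PerronTwo.abs_countFn_sub_main_le (a := cfPWWt A q G ξ ξ₀ x) (ℓ := cfPWLen A Θ x)
    (cfPWWt_nonneg hG0 ξ ξ₀ x) (one_le_cfPWLen hA Θ x.2) hδ (fun σ hσ => summable_cfPW Θ hA h2 hGre hG0 ξ ξ₀ x hσ)
    (cfCongResid_nonneg q Θ hA h2 hG0 x) hσ₀ hσ₀₁ hσ₁ hH hD hκ hM hHb hx2
  rw [countFn_cfPW_eq Θ hA h2 hGre hG0 ξ ξ₀ x hR0] at hmain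
  have hpow : ∀ e : ℝ, (X ^ 2) ^ e = X ^ (2 * e) := fun e => by
    rw [show X ^ 2 = X ^ ((2 : ℕ) : ℝ) from (rpow_natCast X 2).symm, ← rpow_mul hR0]; norm_num
  rw [hpow, hpow] at hmain
  have hexp : 2 * (cfDimension A - (cfDimension A - σ₁) / 3) = 2 * cfDimension A - 2 * ((cfDimension A - σ₁) / 3) := by
    ring
  rw [hexp] at hmain
  exact hmain

/-- The same with the main term through the congruence renewal constant `|Γ_q|^{-1} c_{G,Φ}(x)` of
`cfCongCountT_asymp`: `|N_q(X) − |Γ_q|^{-1} c_{G,Φ}(x) X^{2δ_A}| ≤ C X^{2δ_A − 2(δ_A−σ₁)/3}`.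
[cite: MageeOhWinter2019, Thm. 11] -/
theorem cfCongCountT_powerSaving_of_resolventBound' {G : CfLip}
    (hGre : ∀ y : Icc (0 : ℝ) 1, (((G y).re : ℝ) : ℂ) = G y) (hG0 : ∀ y : Icc (0 : ℝ) 1, 0 ≤ (G y).re)
    (ξ ξ₀ : SL(2, ZMod q)) (x : Icc (0 : ℝ) 1) {σ₀ σ₁ : ℝ} (hσ₀ : 0 ≤ σ₀) (hσ₀₁ : σ₀ < σ₁) (hσ₁ : σ₁ < cfDimension A)
    (hL1 : ∀ s : ℂ, σ₀ < s.re → s ≠ (cfDimension A : ℂ) → IsUnit (1 - cfLOp A hA s))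
    (hL2 : ∀ s : ℂ, σ₀ < s.re → IsUnit (1 + cfLOp A hA s))
    (hB : ∀ s : ℂ, σ₀ < s.re → IsUnit (1 - cfTwB A hA q s))
    {κ M : ℝ} (hκ : κ < 2) (hM : 0 ≤ M)
    (hbound : ∀ u : ℝ, σ₁ ≤ u → u ≤ cfDimension A + 1 → ∀ t : ℝ, (u : ℂ) + t * I ≠ (cfDimension A : ℂ) →
      ‖cfCongRes q Θ hA G ξ ξ₀ x ((u : ℂ) + t * I) -
          (cfCongResid q Θ hA h2 G x : ℂ) / (((u : ℂ) + t * I) - cfDimension A)‖ ≤ M * (1 + |t|) ^ κ)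
    {X : ℝ} (hX : Real.sqrt 2 ≤ X) :
    |cfCongCountT A Θ G ξ ξ₀ X x -
        ((Fintype.card (SL(2, ZMod q)) : ℝ))⁻¹ * cfEvenConst A hA h2 Θ G x * X ^ (2 * cfDimension A)| ≤
      (cfCongResid q Θ hA h2 G x * (2 ^ (cfDimension A + 1) + 1 / cfDimension A) +
          M * (32 / π * 2 ^ (2 + σ₁) * PerronTwo.shiftConst σ₁ κ)) *
        X ^ (2 * cfDimension A - 2 * ((cfDimension A - σ₁) / 3)) := by
  have h := cfCongCountT_powerSaving_of_resolventBound q Θ hA h2 hGre hG0 ξ ξ₀ x hσ₀ hσ₀₁ hσ₁ hL1 hL2 hB hκ hM hbound hX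
  have hδ := (cfDimension_pos hA h2).ne'
  have heq : cfCongResid q Θ hA h2 G x * X ^ (2 * cfDimension A) / cfDimension A =
      ((Fintype.card (SL(2, ZMod q)) : ℝ))⁻¹ * cfEvenConst A hA h2 Θ G x * X ^ (2 * cfDimension A) := by
    rw [cfCongResid_eq]; field_simp
  rwa [heq] at h

end Regular

end Literature.NumberTheory.Sieve
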